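import Summits.Langlands.Langlands.Theorems.AbelianSurfaceSerreSerreGSp4SurjectiveStubAutomorphyLifting
import Literature.NumberTheory.GaloisRepresentations.IrreducibleOfIrreducibleReduction
import HarnessLib

/-!
# Crux `SerreGSp4Surjective` (stmt-Langlands-17765), line `singer-type-evaporation`:
# stub 5/7 `stub_irredOfResidual` — residually irreducible on `Γ_{ℚ(ζ_ℓ)}` ⇒ irreducible over `ℚ̄_ℓ`

Registered signature (skeleton v4), proved VERBATIM below: for an `ℓ`-adic
`r' : Γ_ℚ → GL₄(ℚ̄_ℓ)` reducing ALONG a residue map `red : 𝒪_{ℚ̄_ℓ} → k̄` (`ReducesAlong`, the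
landed stub-4 module) to a `ρ' : Γ_ℚ → GL₄(k)`, `k` finite of characteristic `ℓ`, such that
`ρ' ⊗ k̄` is irreducible on `ker ε̄_ℓ = Γ_{ℚ(ζ_ℓ)}` (`IrredOnCycKernel`), the Galois representation
`r'` on `ℚ̄_ℓ⁴` is irreducible — the hypothesis "`ρ` irreducible" of BLGGT Thm 4.2.1 fed by the line's
composition.

Proof (folklore; Darmon–Diamond–Taylor 1995, §2.1): (1) `red` kills the maximal ideal of the
rank-one valuation ring `𝒪_{ℚ̄_ℓ}` (`‖x‖ < 1 ⇒ ‖x^N‖ ≤ ‖ℓ‖`, so `red(x)^N ∈ red(ℓ𝒪) = 0`), hence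
factors as `ι ∘ (mod 𝔪)` for a field embedding `ι : 𝒪/𝔪 →+* k̄` (`exists_residueField_factor`, the
wave-1 computation of the `stub_singerFamily` audit, re-derived for this spelling of `𝒪`); (2) so
`ReducesAlong ℓ red r' ρ'` says exactly that `σ := ρ' ⊗ k̄` has the residual characteristic
polynomials of `r'` along `ι` (`HasResidualCharpolys`, unique integral lifts); (3) `σ` is
irreducible because its restriction to `ker ε̄_ℓ` is
(`Literature.RepresentationTheory.Semisimple.Representation.isIrreducible_of_isIrreducible_comp`);
(4) the general theorem `FramedGaloisRep.isIrreducible_of_hasResidualCharpolys` of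
`Literature/NumberTheory/GaloisRepresentations/IrreducibleOfIrreducibleReduction.lean` (stable
lattice over the non-Noetherian `ℤ̄_ℓ`, saturation of a stable subspace, block-triangular integral
model, reduction, Brauer–Nesbitt over an arbitrary field) concludes.  No named fact is used.

References: Darmon–Diamond–Taylor, *Fermat's Last Theorem* (1995), §2.1; Barnet-Lamb–Gee–Geraghty–
Taylor, *Potential automorphy and change of weight* (2014), Thm 4.2.1 (the consumer).
-/

set_option linter.dupNamespace false -- `Summit.Langlands.Langlands` is the mandated namespace

namespace Summit.Langlands.Langlands.Cruxes.SerreGSp4Surjective.SingerTypeEvaporation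

open Literature.NumberTheory.GaloisRepresentations Literature.NumberTheory.Automorphic
  Literature.NumberTheory.PAdicHodge
open scoped NumberField
open IsDedekindDomain Polynomial

noncomputable section

/-! ## Every `red : 𝒪_{ℚ̄_ℓ} →+* K'` with `char K' = ℓ` is reduction modulo `𝔪` -/

section Red

variable {ℓ : ℕ} [Fact ℓ.Prime] {K' : Type*} [Field K'] [CharP K' ℓ]

/-- Any ring map `red : 𝒪_{ℚ̄_ℓ} → K'` to a field of characteristic `ℓ` kills the elements of
valuation `< 1` (`‖x‖^N ≤ ‖ℓ‖` for large `N`, so `x^N ∈ ℓ𝒪` and `red(x)^N = 0`).  (Wave-1 lemma of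
the `stub_singerFamily` audit, prover-line-stmt-Langlands-17765, same crux.) [folklore] -/
theorem red_eq_zero_of_v_lt_one
    (red : (Valued.v : Valuation (PadicAlgCl ℓ) NNReal).valuationSubring →+* K')
    (x : (Valued.v : Valuation (PadicAlgCl ℓ) NNReal).valuationSubring)
    (hx : Valued.v (x : PadicAlgCl ℓ) < 1) : red x = 0 := by
  have hx' : ‖(x : PadicAlgCl ℓ)‖ < 1 := by
    rw [PadicAlgCl.valuation_def] at hx
    exact_mod_cast hx
  have hp0 : 0 < ‖((ℓ : ℕ) : PadicAlgCl ℓ)‖ :=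
    norm_pos_iff.2 (Nat.cast_ne_zero.2 (Fact.out : ℓ.Prime).ne_zero)
  obtain ⟨N, hN⟩ := exists_pow_lt_of_lt_one hp0 hx'
  have hz : ‖(x : PadicAlgCl ℓ) ^ N / (ℓ : PadicAlgCl ℓ)‖ ≤ 1 := by
    rw [norm_div, norm_pow]
    exact (div_le_one hp0).2 hN.le
  have hzmem : (x : PadicAlgCl ℓ) ^ N / (ℓ : PadicAlgCl ℓ) ∈
      (Valued.v : Valuation (PadicAlgCl ℓ) NNReal).valuationSubring := by
    rw [Valuation.mem_valuationSubring_iff, PadicAlgCl.valuation_def]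
    exact_mod_cast hz
  set z : (Valued.v : Valuation (PadicAlgCl ℓ) NNReal).valuationSubring := ⟨_, hzmem⟩ with hzdef
  have hxN : x ^ N =
      ((ℓ : ℕ) : (Valued.v : Valuation (PadicAlgCl ℓ) NNReal).valuationSubring) * z := by
    apply Subtype.ext
    have hp0' : (ℓ : PadicAlgCl ℓ) ≠ 0 := norm_pos_iff.1 hp0
    change
      ((x ^ N : (Valued.v : Valuation (PadicAlgCl ℓ) NNReal).valuationSubring) : PadicAlgCl ℓ) =
      (((ℓ : ℕ) : (Valued.v : Valuation (PadicAlgCl ℓ) NNReal).valuationSubring) : PadicAlgCl ℓ) *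
        ((x : PadicAlgCl ℓ) ^ N / (ℓ : PadicAlgCl ℓ))
    push_cast
    field_simp
  have h0 : red x ^ N = 0 := by
    rw [← map_pow, hxN, map_mul, map_natCast, CharP.cast_eq_zero, zero_mul]
  exact eq_zero_of_pow_eq_zero h0

/-- Hence `red` kills the maximal ideal of the (rank-one) valuation ring `𝒪_{ℚ̄_ℓ}`. [folklore] -/
theorem red_eq_zero_of_mem_maximalIdeal
    (red : (Valued.v : Valuation (PadicAlgCl ℓ) NNReal).valuationSubring →+* K')
    {x : (Valued.v : Valuation (PadicAlgCl ℓ) NNReal).valuationSubring}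
    (hx : x ∈ IsLocalRing.maximalIdeal _) : red x = 0 := by
  refine red_eq_zero_of_v_lt_one red x ?_
  rw [ValuationSubring.valuation_lt_one_iff] at hx
  exact (Valuation.isEquiv_valuation_valuationSubring _).lt_one_iff_lt_one.2 hx

/-- … so `red` is a local homomorphism. [folklore] -/
theorem isLocalHom_red
    (red : (Valued.v : Valuation (PadicAlgCl ℓ) NNReal).valuationSubring →+* K') :
    IsLocalHom red := by
  refine ⟨fun x hx ↦ ?_⟩
  by_contra h
  exact hx.ne_zero (red_eq_zero_of_mem_maximalIdeal red ((IsLocalRing.mem_maximalIdeal _).2 h))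

/-- **No junk `red`**: every `red : 𝒪_{ℚ̄_ℓ} →+* K'`, `char K' = ℓ`, factors through the residue
field `𝒪/𝔪` of `𝒪_{ℚ̄_ℓ}` along a (necessarily injective) `ι : 𝒪/𝔪 →+* K'`. [folklore] -/
theorem exists_residueField_factor
    (red : (Valued.v : Valuation (PadicAlgCl ℓ) NNReal).valuationSubring →+* K') :
    ∃ ι : IsLocalRing.ResidueField
        (Valued.v : Valuation (PadicAlgCl ℓ) NNReal).valuationSubring →+* K',
      ι.comp (IsLocalRing.residue _) = red := by
  haveI := isLocalHom_red red
  exact ⟨IsLocalRing.ResidueField.lift red,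
    RingHom.ext fun x ↦ IsLocalRing.ResidueField.lift_residue_apply red x⟩

end Red

/-! ## `ReducesAlong` in the tree's vocabulary, and the stub -/

/-- **`ReducesAlong` is `HasResidualCharpolys`**: if `r` reduces to `ρ'` along `red = ι ∘ (mod 𝔪)`,
then `ρ' ⊗ k̄` (the homomorphism `GL₄(k → k̄) ∘ ρ'`) has the residual characteristic polynomials of
`r` along `ι` (`det(X - (ρ' ⊗ k̄)(g)) = det(X - ρ'(g))` mapped to `k̄`, Mathlib
`Matrix.charpoly_map`).
[folklore] -/
theorem ReducesAlong.hasResidualCharpolys {ℓ : ℕ} [Fact ℓ.Prime] {k : Type} [Field k]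
    [TopologicalSpace k]
    {red : (Valued.v : Valuation (PadicAlgCl ℓ) NNReal).valuationSubring →+* AlgebraicClosure k}
    {r : FramedGaloisRep ℚ (PadicAlgCl ℓ) 4} {ρ' : FramedGaloisRep ℚ k 4}
    (h : ReducesAlong ℓ red r ρ') {ι : padicAlgClResidueField ℓ →+* AlgebraicClosure k}
    (hι : ι.comp (IsLocalRing.residue _) = red) :
    HasResidualCharpolys ι (r : Field.absoluteGaloisGroup ℚ →* GL (Fin 4) (PadicAlgCl ℓ))
      ((Matrix.GeneralLinearGroup.map (algebraMap k (AlgebraicClosure k))).comp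
        (ρ' : Field.absoluteGaloisGroup ℚ →* GL (Fin 4) k)) := by
  intro g
  obtain ⟨P, hP, hPred⟩ := h g
  refine ⟨P, hP, ?_⟩
  rw [hι, hPred, FramedRep.charpoly, ← Matrix.charpoly_map]
  rfl

/-- **Stub `stub_irredOfResidual` (registered signature, verbatim).**  If the `ℓ`-adic
`r' : Γ_ℚ → GL₄(ℚ̄_ℓ)` reduces along `red : 𝒪_{ℚ̄_ℓ} → k̄` to `ρ' : Γ_ℚ → GL₄(k)` (`k` finite of
characteristic `ℓ`) and `ρ' ⊗ k̄` is irreducible on `ker ε̄_ℓ`, then `r'` is irreducible as a Galois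
representation on `ℚ̄_ℓ⁴`: `red = ι ∘ (mod 𝔪)` (`exists_residueField_factor`), so `ρ' ⊗ k̄` has the
residual characteristic polynomials of `r'` along `ι` (`ReducesAlong.hasResidualCharpolys`); it is
irreducible since its restriction to `ker ε̄_ℓ` is; and an `ℓ`-adic representation with an
irreducible reduction is irreducible (`FramedGaloisRep.isIrreducible_of_hasResidualCharpolys`:
stable `ℤ̄_ℓ`-lattice, saturation, Brauer–Nesbitt).  The hypotheses `Fintype k`, `CharP k ℓ`,
`DiscreteTopology k` of the registration are not needed beyond `CharP k ℓ`. [folklore] -/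
theorem stub_irredOfResidual :
    ∀ (ℓ : ℕ) [Fact ℓ.Prime] (r' : FramedGaloisRep ℚ (PadicAlgCl ℓ) 4)
      (k : Type) [Field k] [Fintype k] [CharP k ℓ] [TopologicalSpace k] [DiscreteTopology k]
      (ρ' : FramedGaloisRep ℚ k 4)
      (red : (Valued.v : Valuation (PadicAlgCl ℓ) NNReal).valuationSubring →+* AlgebraicClosure k),
      ReducesAlong ℓ red r' ρ' → IrredOnCycKernel ℓ ρ' → r'.toGaloisRep.IsIrreducible := by
  intro ℓ _ r' k _ _ _ _ _ ρ' red hred hN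
  -- (1) `red = ι ∘ (mod 𝔪)`
  obtain ⟨ι, hι⟩ := exists_residueField_factor red
  -- (2) `ρ' ⊗ k̄` has the residual characteristic polynomials of `r'` along `ι`
  have hres := hred.hasResidualCharpolys hι
  -- (3) `ρ' ⊗ k̄` is irreducible, its restriction to `ker ε̄_ℓ` being irreducible
  have hσ : (glRepresentation
      ((Matrix.GeneralLinearGroup.map (algebraMap k (AlgebraicClosure k))).comp
        (ρ' : Field.absoluteGaloisGroup ℚ →* GL (Fin 4) k))).IsIrreducible :=
    Literature.RepresentationTheory.Semisimple.Representation.isIrreducible_of_isIrreducible_comp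
      _ (modPCyclotomicCharacterZMod ℚ ℓ).ker.subtype hN
  -- (4) irreducible reduction ⇒ irreducible
  exact r'.isIrreducible_of_hasResidualCharpolys hres hσ

end

end Summit.Langlands.Langlands.Cruxes.SerreGSp4Surjective.SingerTypeEvaporation
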